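import Literature.MathematicalPhysics.QuantumFieldTheory.Balaban1983to89.B15Prop1CarrierStdB
import Literature.MathematicalPhysics.QuantumFieldTheory.Balaban1983to89.B15Eq177GaugeInvarianceB

/-!
# `Balaban1983to89.B15Prop1CarrierStdBBridges` — [Balaban1989LargeFieldI] (= [B15]) Proposition 1 p. 194, print's instance OVER `(bg : DetBackgroundB, bd)`: THE «MINIMAL ORBIT» THEOREMS
# over the [15] (181) covariance (THEOREMS-ONLY companion of the statement-only module `B15Prop1CarrierStdB`; twins of `B15Prop1Carrier.std_f_gaugeAct ∕ IsMinPt.std_gaugeAct ∕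
# isMinimum_std_iff_forall ∕ isMinimumOn_std_iff_forall`, proofs verbatim with `Cov181B bg (bd k (maxDomT M₁ Z))` for `Cov181 bg (Bj M₁ Z k)`)

statement-level skeleton of published theorems with citation tags; proofs where landed; nothing here is a claim about the
Yang–Mills mass gap

Cell `pub-ymgap` (HUMAN RULINGS D-0062 ∕ D-0149), lane `pub-ymgap-dag-n12-c` g34 (R134 seat (a), N12 = [B15], s1); `--kind proof --supports` K1⁹ `stmt-QuantumFields-27364`;
count-neutral.  THEOREMS ONLY (0 `def`, 0 `instance`, 0 `sorry`).  HONESTY GUARD (director-ym №338 (5)): purely additive; the (b)-instance theorems of `B15Prop1Carrier` §9 ∕ §10 stay landed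
and true on their own text; nothing elsewhere is edited; (181) is a displayed, located HYPOTHESIS (`Cov181B`), never asserted.

WHAT IS HERE.
* `stdB_f_gaugeAct` — at print's instance over `(bg, bd)` the function (1.77) is invariant under every gauge transformation of `T^{(k)}` (in particular those *"defined on Λ"*), over (181) at
  `bd k (maxDomT M₁ Z)` (`B15Eq177GaugeInvarianceB.fun177stdB_gaugeAct`).
* `IsMinPt.stdB_gaugeAct` — a minimum stays a minimum along its `Λ`-orbit.
* `isMinimum_stdB_iff_forall` ∕ `isMinimumOn_stdB_iff_forall` — the carrier's `IsMinimum` conjunct at the instance (without ∕ with print's example domain) holds iff EVERY element of the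
  orbit is a minimum: the *"minimal orbit"* of p. 194.

HONEST SCOPE.  Bookkeeping over the carrier's kernel lemmas `exists_isMinPt(On)_iff_forall`; nothing of Bałaban's analysis asserted or proved; `B15.Prop1Printed` NOT inhabited; count-neutral;
N12 NOT discharged; K0⁷ ∕ K1⁹ NOT closed; the Yang–Mills mass gap (Clay) is NOT proved by any of this.

References: [B15] = [Balaban1989LargeFieldI] (1.77)–(1.78) Prop. 1 p.194; [15] = [Balaban1985Variational] (181) p.307; [II] = [Balaban1984PropagatorsII] (2.3) p.224; [I] =
[Balaban1987RG1] (0.1) p.251.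
-/

noncomputable section

open Set

namespace Literature.MathematicalPhysics.QuantumFieldTheory.Balaban1983to89.B15Prop1Carrier

open Literature.MathematicalPhysics.QuantumFieldTheory.Balaban1983to89
open B15DeterminingSets B15DeterminingSetsB B14.Eq213DetSet B14.Eq216Concrete B8Eq17ClassAkV1 GaugeField
open Literature.MathematicalPhysics.QuantumFieldTheory.BalabanImbrieJaffe1984to88.BIJ85Eq453GaugeField
open B16Sect1Backgrounds B14.Eq12InteriorLocality B15Sect1Instances B15Eq177GaugeInvariance

variable {P : Params}

section StdBOrbit

variable {G : Type} [GaugeGroup G] {𝔤 : Type*} [AddCommGroup 𝔤] [Module ℝ 𝔤] {av : ∀ j, Averaging P j G}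
  (bg : DetBackgroundB P G av) (M₁ : ℕ) (bd : ℕ → (ℕ → Set (Site P 0)) → BDetSet P)

/-- At print's instance over `(bg, bd)` the function (1.77) is invariant under the gauge transformations defined on `Λ^{(k)}` — indeed under all of `T^{(k)}`'s
(`fun177stdB_gaugeAct`) — over the [15] (181) covariance `Cov181B` at `bd k (maxDomT M₁ Z)` (`k` in the `Params` range); twin of `std_f_gaugeAct`.
[cite: Balaban1989LargeFieldI, (1.77) p.194; Balaban1985Variational, (181) p.307] -/
theorem stdB_f_gaugeAct {Z : Set (Site P 0)} {k : ℕ} (hk : k ≤ P.m + P.K) (h181 : ∀ u : GaugeTransf P k G, Cov181B bg (bd k (maxDomT M₁ Z)) (blockLift k u))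
    (Λ : Set (Site P 0)) (M : ℝ) (An : ℝ → GaugeField P k G → Prop) (u : GaugeTransf P k G) (_hu : IsGaugeOn (pts k Λ) u) (V : GaugeField P k G) :
    (Inst.stdB bg M₁ bd Z Λ k M An).f (gaugeAct u V) = (Inst.stdB bg M₁ bd Z Λ k M An).f V :=
  fun177stdB_gaugeAct bg M₁ bd hk u (h181 u) V

/-- At print's instance over `(bg, bd)` a minimum stays a minimum along its `Λ`-orbit (`isVLambdaStdB_gaugeAct`, over (181)); twin of `IsMinPt.std_gaugeAct`.
[cite: Balaban1989LargeFieldI, Prop. 1 (1.78) p.194; Balaban1985Variational, (181) p.307] -/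
theorem IsMinPt.stdB_gaugeAct {Z Λ : Set (Site P 0)} {k : ℕ} (hk : k ≤ P.m + P.K) {u : GaugeTransf P k G} (hu : IsGaugeOn (pts k Λ) u)
    (h181 : Cov181B bg (bd k (maxDomT M₁ Z)) (blockLift k u)) {Vk VΛ : GaugeField P k G} (h : IsMinPt (bondsOf (pts k Λ)) (fun177stdB bg M₁ bd Z k) Vk VΛ) :
    IsMinPt (bondsOf (pts k Λ)) (fun177stdB bg M₁ bd Z k) Vk (GaugeField.gaugeAct u VΛ) :=
  isVLambdaStdB_gaugeAct bg M₁ bd hk hu h181 h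

/-- At print's instance over `(bg, bd)`, over (181): the `IsMinimum` conjunct of the carrier (*"An element of the orbit is a minimum"*) holds iff EVERY element of the orbit is a minimum —
the *"minimal orbit"* of p. 194; twin of `isMinimum_std_iff_forall`. [cite: Balaban1989LargeFieldI, Prop. 1 p.194; Balaban1985Variational, (181) p.307] -/
theorem isMinimum_stdB_iff_forall (ch : ExpChart G 𝔤) {ι : Type} {Z Λ : ι → Set (Site P 0)} {k : ι → ℕ} {M : ι → ℝ} {An : (i : ι) → ℝ → GaugeField P (k i) G → Prop}
    (hk : ∀ i, k i ≤ P.m + P.K) (h181 : ∀ i (u : GaugeTransf P (k i) G), Cov181B bg (bd (k i) (maxDomT M₁ (Z i))) (blockLift (k i) u)) (i : ι) (Vk : GaugeField P (k i) G)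
    (O : OrbitSp G (pts (k i) (Λ i))) :
    (lfVar ch (fun i => Inst.stdB bg M₁ bd (Z i) (Λ i) (k i) (M i) (An i))).IsMinimum i Vk O ↔
      ∀ V ∈ O.1, IsMinPt (bondsOf (pts (k i) (Λ i))) (fun177stdB bg M₁ bd (Z i) (k i)) Vk V :=
  exists_isMinPt_iff_forall (fun u hu V => stdB_f_gaugeAct bg M₁ bd (hk i) (h181 i) (Λ i) (M i) (An i) u hu V) O

/-- At print's instance with its example domain over `(bg, bd)`, over (181): the `IsMinimum` conjunct of the carrier of record holds iff EVERY element of the orbit is a minimum over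
(variables ∩ domain); twin of `isMinimumOn_std_iff_forall`. [cite: Balaban1989LargeFieldI, Prop. 1 p.194; Balaban1985Variational, (181) p.307] -/
theorem isMinimumOn_stdB_iff_forall (ch : ExpChart G 𝔤) {ι : Type} {Z Λ : ι → Set (Site P 0)} {k : ι → ℕ} {M a₁ : ι → ℝ} {An : (i : ι) → ℝ → GaugeField P (k i) G → Prop}
    (hk : ∀ i, k i ≤ P.m + P.K) (h181 : ∀ i (u : GaugeTransf P (k i) G), Cov181B bg (bd (k i) (maxDomT M₁ (Z i))) (blockLift (k i) u)) (i : ι) (Vk : GaugeField P (k i) G)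
    (O : OrbitSp G (pts (k i) (Λ i))) :
    (lfVarOn ch (fun i => InstOn.stdB bg M₁ bd (Z i) (Λ i) (k i) (M i) (a₁ i) (An i))).IsMinimum i Vk O ↔
      ∀ V ∈ O.1, IsMinPtOn (extSet (bondsOf (pts (k i) (Λ i))) Vk ∩ domReg (Z i) (k i) (a₁ i)) (fun177stdB bg M₁ bd (Z i) (k i)) V :=
  exists_isMinPtOn_iff_forall (fun u hu V => stdB_f_gaugeAct bg M₁ bd (hk i) (h181 i) (Λ i) (M i) (An i) u hu V) (fun u _ _ hV => gaugeAct_mem_domReg u hV) O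

end StdBOrbit

end Literature.MathematicalPhysics.QuantumFieldTheory.Balaban1983to89.B15Prop1Carrier

end
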